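import Mathlib
import HarnessLib.Audit
import Summits.PneNP.PneNP.Theorems.PstarGateAffine
import Summits.PneNP.PneNP.Theorems.PstarChordBridgeCorner

/-!
# One GATED chord, CASE T: the other chords against the global clean member `φ = q_m + ℓ` — OR family, (EQ), (EXC) or (NOR) (E2 (T2); prover-1 g18)

FRONTIER range-avoidance ladder, rung F-N3 (`stmt-PneNP-19007`), cell `pnp-ideate` (this seat's `HOME/pnp-ideate-prover-1/g18/E2-PLAN.md` §2 B2 CASE T,
§4 (T2)); restricted-model proof complexity — nothing here bears on `P` versus `NP`.

In CASE T every other chord `e'` is ON on the zero set of the GLOBAL quadratic `φ := q_m + ℓ` (`PstarGateAffine.caseT_forced_on_Z`), whose polar form is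
`polarDir I B m` (the coefficient `ℓ = κ₀ + x_u` is affine).  `PstarForcing.forcing_cases` (rank `≥ 4` of `Q_{D e'}` from expansion) then gives the
CASE T tetrachotomy, with NO minimality hypothesis:

* `phi_add` — `φ` is quadratic with polar form `polarDir I B m`;
* `caseT_phi_cases` — **`φ ≡ 1` (the OR-READER family: `R + ℓ` is the infeasible constant), or `e'` is (EQ) `Q_{D e'} = φ + κ`, or (EXC)
  `Q_{D e'} = φ + ν₁ν₂ + κ`, or (NOR) w.r.t. `φ`** — generalising `caseT_affine_const` (affine `φ` has no (EQ)/(EXC)/(NOR) chord of rank four);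
* `caseT_phi_EQ_unique` — at most one other chord is (EQ) w.r.t. `φ` (`chord_eq_of_EQ`).
-/

set_option linter.dupNamespace false -- `Summit.PneNP.PneNP.…`: summit = sub-problem name (D-0017 single-conjunct layout)

open Finset Module Literature.Computability.Complexity
open Summit.PneNP.PneNP.Theorems.PstarTyped (Typed)
open Summit.PneNP.PneNP.Theorems.PstarSALevel (varSet bdry BoundaryExpanding SimpleOverlap)
open Summit.PneNP.PneNP.Theorems.PstarCubeIdeals (IsAffineFn)
open Summit.PneNP.PneNP.Theorems.PstarProductRank (qform)
open Summit.PneNP.PneNP.Theorems.PstarForcing (forcing_cases)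
open Summit.PneNP.PneNP.Theorems.PstarReadSumset (V2)
open Summit.PneNP.PneNP.Theorems.PstarChordSystem (ChordSystem)
open Summit.PneNP.PneNP.Theorems.PstarChordBridgeTools (privs coef)
open Summit.PneNP.PneNP.Theorems.PstarChordBridge (BridgeData sys Solution Lift)
open Summit.PneNP.PneNP.Theorems.PstarChordBridgeForcing (gam qform_add' rank_four_of_wf chord_eq_of_EQ)
open Summit.PneNP.PneNP.Theorems.PstarChordBridgeBasis (qDir polarDir)
open Summit.PneNP.PneNP.Theorems.PstarChordBridgeCorner (qDir_add)
open Summit.PneNP.PneNP.Theorems.PstarGateBridge (GateHyp)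
open Summit.PneNP.PneNP.Theorems.PstarGateAffine (caseT_forced_on_Z)

namespace Summit.PneNP.PneNP.Theorems.PstarGateCaseTPhi

variable {n m : ℕ}

/-- The global clean member `φ := q_m + ℓ` of CASE T (with one gate of coefficient `κ₀ + x_u`). -/
def phi (I : LocalMap 4 n m) (B : BridgeData n m) (mv : V2) (u : Fin n) (κ₀ : ZMod 2) (x : Fin n → ZMod 2) : ZMod 2 :=
  qDir I B mv x + (κ₀ + x u)

/-- **`φ` is quadratic with the polar form of `q_m`.** -/
theorem phi_add (I : LocalMap 4 n m) (B : BridgeData n m) (mv : V2) (u : Fin n) (κ₀ : ZMod 2) (x w : Fin n → ZMod 2) :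
    phi I B mv u κ₀ (x + w) = phi I B mv u κ₀ x + phi I B mv u κ₀ w + phi I B mv u κ₀ 0 + polarDir I B mv x w := by
  unfold phi
  rw [qDir_add I B mv x w, Pi.add_apply, Pi.zero_apply]
  ring_nf
  have h3 : κ₀ * 3 = κ₀ := by generalize κ₀ = k; revert k; decide
  rw [h3]

/-- **CASE T against `φ`: OR family, (EQ), (EXC) or (NOR).**  One-gate data, CASE T (`mv ∈ {(0,1),(1,1)}`, others read along `mv` and are read),
(T3), one gate of coefficient `κ₀ + x_u`, `#J₀ ≤ r` on a pure `(r,3/2)`-expanding instance with simple overlaps, `e' ≠ e` a chord. -/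
theorem caseT_phi_cases (I : LocalMap 4 n m) (hI : I.IsPure xorAndPred) (hT : Typed I) (hS : SimpleOverlap I) {r : ℕ}
    (hB : BoundaryExpanding r I) {B : BridgeData n m} (hW : B.WF I) (hJr : B.J₀.card ≤ r) (hL : Lift I B) {e : Fin m} (hG : GateHyp I B e)
    (hT3 : ¬ ∃ z, Solution I B B.J₀ z) {mv : V2} (hmvT : mv = (0, 1) ∨ mv = (1, 1))
    (hP : ∀ e' ∈ B.N, e' ≠ e → ∀ a, ((sys I B).ρ e' a = 0 ∨ (sys I B).ρ e' a = mv) ∧ ((sys I B).ρ' e' a = 0 ∨ (sys I B).ρ' e' a = mv))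
    (hread : ∀ e' ∈ B.N, e' ≠ e → ∀ a, (sys I B).ρ e' a ≠ 0 ∨ (sys I B).ρ' e' a ≠ 0)
    {u : Fin n} {κ₀ : ZMod 2} (hcoef : ∀ x, coef I B.C₁ B.G₁ (I.vars e 2) x = κ₀ + x u) {e' : Fin m} (he' : e' ∈ B.N) (hne : e' ≠ e) :
    (∀ x, phi I B mv u κ₀ x = 1) ∨
    (∃ κ : ZMod 2, ∀ x, qform (B.D e') (fun j => I.vars j 2) (fun j => I.vars j 3) x = phi I B mv u κ₀ x + κ) ∨
    (∃ ν₁ ν₂ : (Fin n → ZMod 2) → ZMod 2, IsAffineFn ν₁ ∧ IsAffineFn ν₂ ∧ ∃ κ : ZMod 2, ∀ x,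
      qform (B.D e') (fun j => I.vars j 2) (fun j => I.vars j 3) x = phi I B mv u κ₀ x + ν₁ x * ν₂ x + κ) ∨
    (∃ a b : Fin n → ZMod 2, polarDir I B mv a b = 1 ∧
      (∀ x, phi I B mv u κ₀ x =
        (polarDir I B mv x b + (phi I B mv u κ₀ b + phi I B mv u κ₀ 0)) * (polarDir I B mv x a + (phi I B mv u κ₀ a + phi I B mv u κ₀ 0)) + 1) ∧
      ∃ m₁ m₂ : (Fin n → ZMod 2) → ZMod 2, IsAffineFn m₁ ∧ IsAffineFn m₂ ∧
        ∀ x, qform (B.D e') (fun j => I.vars j 2) (fun j => I.vars j 3) x + (gam B e' + 1) =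
          (polarDir I B mv x b + (phi I B mv u κ₀ b + phi I B mv u κ₀ 0) + 1) * m₁ x +
          (polarDir I B mv x a + (phi I B mv u κ₀ a + phi I B mv u κ₀ 0) + 1) * m₂ x) := by
  classical
  have hZ : ∀ x, phi I B mv u κ₀ x = 0 → qform (B.D e') (fun j => I.vars j 2) (fun j => I.vars j 3) x = gam B e' + 1 := by
    intro x hx
    refine caseT_forced_on_Z I hI hT hW hL hG hT3 hmvT hP hread ?_ e' he' hne
    rw [hcoef]; exact hx
  exact forcing_cases (phi_add I B mv u κ₀) (qform_add' I (B.D e')) (rank_four_of_wf I hI hS hB hW hJr he') hZ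

/-- **At most one other chord is (EQ) w.r.t. `φ`.** -/
theorem caseT_phi_EQ_unique (I : LocalMap 4 n m) (hI : I.IsPure xorAndPred) (hS : SimpleOverlap I) {B : BridgeData n m} (hW : B.WF I)
    {mv : V2} {u : Fin n} {κ₀ : ZMod 2} {e' e'' : Fin m} (he' : e' ∈ B.N) (he'' : e'' ∈ B.N) {κ κ' : ZMod 2}
    (h' : ∀ x, qform (B.D e') (fun j => I.vars j 2) (fun j => I.vars j 3) x = phi I B mv u κ₀ x + κ)
    (h'' : ∀ x, qform (B.D e'') (fun j => I.vars j 2) (fun j => I.vars j 3) x = phi I B mv u κ₀ x + κ') : e' = e'' :=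
  chord_eq_of_EQ I hI hS hW he' he'' h' h''

end Summit.PneNP.PneNP.Theorems.PstarGateCaseTPhi
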